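import Summits.BirchSwinnertonDyer.Rank1Residual.Additive.QuadraticBranchMazurTateThreeTerm
import Literature.NumberTheory.EllipticCurves.PAdicLFunctionInvolutionProofs
import Literature.NumberTheory.EllipticCurves.AtkinLehnerMinusSymbolSymmetryProofs
import Literature.NumberTheory.EllipticCurves.AtkinLehnerFrickeLevelProofs
import HarnessLib

/-!
# Route `QuadraticBranchSignedControl` (rung K8, cell `bsd-potss`), residual crux `PlusEtaMainConjectureNonsurj`
# (stmt-BirchSwinnertonDyer-19606): THE FUNCTIONAL EQUATION OF THE MAZUR–TATE ELEMENTS `θ_n(η)` ON THE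
# QUADRATIC BRANCH, I — the coefficient symmetry `B_n(s) = w · B_n(−s_N − s)` and its SIGN `w = σ · (−N | p)`
# (seat `bsd-potss-k8eta-c2` g27; kernel tool, finite level, every row of the crux and every `a_p`)

WHY. Every analytic instrument of this crux (g13 MT-L, g23 MT-C1, g24–g26 coefficient congruences / readings /
quotient) reads Kobayashi's `L_p^±(V, η, X)` off the tree's quadratic-branch Mazur–Tate elements
`θ_n(η) = quadraticBranchMazurTateElement p f n = ∑_{w ∈ μ_{p−1}} ∑_{s mod pⁿ} η(w)[wγ^s/p^{n+1}]^δ_f (1+T)^s`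
(`η = ω^{(p−1)/2}`, `[·]^δ` the modular symbol of the parity of `η`). The one structural identity these
elements satisfy that the tree did not yet have on the quadratic branch is their FUNCTIONAL EQUATION under the
Iwasawa involution `σ_a ↦ σ_a⁻¹` (Mazur–Tate–Teitelbaum 1986, §I.17; for the trivial branch at ordinary /
multiplicative `p` the tree proves it in `PAdicFunctionalEquationParityProofs` /
`PAdicLFunctionMinusMultFunctionalEquationProofs`). On the quadratic branch the tame character is SELF-DUAL
(`η̄ = η`), so the functional equation relates `θ_n(η)` to ITSELF, and — the point of this file — its sign is
NOT the Fricke sign `σ = −ε(f)` of `f` (the root number `w_V` of the good twist `V`) but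
`w = σ · η(−N) = σ · (−N | p)`, the root number of the ADDITIVE PARTNER `W = V ⊗ η = V^{(p*)}`: the factor
`η(−N)` by which a general tame twist `ψ` is moved to `ψ̄` enters once, not twice. Consequences drawn in the
sequel files: the parity law `(−1)^{λ^±(V,η)} = w(W)` for the `λ`-invariants of BOTH signed `p`-adic
`L`-functions (so `λ⁺ ≡ λ⁻ (mod 2)`, sign-free), `θ_{2m}(η)(0) = 0` whenever `w(W) = −1`, and the `Λ`-adic
form `ι θ_n(η) ≡ w (1+T)^{s_N} θ_n(η) (mod ω_n)`. Census P-27S (k8eta-c2 g27, exact fold of the lineage's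
symbol vectors, HOME `k8eta-c2/g27/tables/`): the symmetry holds EXACTLY on 18771/18779 level-vectors
(`p = 5`: levels 1–4; `p = 7, 11`: levels 1–2; the 8 exceptions are the 4 declared FE-degenerate unfixed
engine outputs of g25, whose fixed re-runs pass), and `w = w_V · (−N_V | p) = ε(W)` on 205/205 rows.

MATHEMATICS (no analysis; the tree's Fricke symmetry + finite group theory on `(ℤ/p^{n+1})^×`).
(1) FRICKE: `w_N f = −σ f` gives `[u/M]^± = σ [u'/M]^±` whenever `N u u' ≡ −1 (mod M)`, `M = p^{n+1}`
(tree: `ratPlusSymbol_div_eq_mul_atkinLehner`, `ratMinusSymbol_div_eq_mul_atkinLehner` at `Q = N`; §2 for the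
branch symbol of either parity). (2) COORDINATES: `u = w γ^s` (`w ∈ μ_{p−1}`, `s mod pⁿ`, `γ = 1 + p`) and
`N ≡ η_N γ^{s_N}` (tree: `exists_teichmuller_exponent_natCast`) give the partner
`u' = ((−1) η_N⁻¹ w⁻¹) γ^{−s_N − s}` (§3, tree `classMap_mul` / `classMap_neg_one`). (3) η QUADRATIC:
`η(w) = η(−1) η(η_N) η(w')` since `η² = 1` (§1). Summing over `w` along the involution `w ↦ w'`:
`B_n(s) = σ η(−1) η(η_N) · B_n(−s_N − s)` (§4). (4) THE SIGN (§5): `η(η_N) = η_N^{(p−1)/2} ≡ N^{(p−1)/2}`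
(reduce `N ≡ η_N γ^{s_N}` mod `p`, `γ ≡ 1`) is the Legendre symbol `(N | p)` by Euler's criterion, and
`η(−1) = (−1)^{(p−1)/2} = (−1 | p)`, so the sign is `σ · (−N | p)`; for the newform of `V` at level `N = N_V`,
`σ = w_V` and `σ (−N_V | p) = w_V η(−N_V) = w(V ⊗ η) = w(W)`.

WHAT. §1 `teichSign_one/inv/div/partner/negOne`; §2 `branchSymbol_eq_mul_of_fricke` (both parities),
`exists_frickeSign_of_isNewform0` (`σ = ±1` exists for a newform: Atkin–Lehner, a tree theorem); §3
`natCast_mul_class_mul_partnerClass` (`N u u' = −1`); §4 **`coeffSum_eq_sign_mul_coeffSum`** (the coefficient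
symmetry); §5 `teichSign_eq_legendreSym` (`η(η_N) = (N | p)`), **`sign_eq_mul_legendreSym_neg`**
(`σ η(−1) η(η_N) = σ (−N | p)`).

HONEST FRAMING (cell `bsd-potss`; FULL-BSD rank ≤ 1 programme, HUMAN RULING D-0036/D-0074): TOOL THEOREMS ONLY —
no definition, no named fact, no `sorry`, axioms standard; hypotheses are the Fricke relation `w_N f = −σ f`
(a theorem for newforms, §2) and the class of `N` (a theorem, `exists_classMap_eq_natCast`); nothing about (A),
(C1⁺_η), C-cc-1 or `BSD(W,p)` of any pair is claimed; no stub of 19606 is proved; crux and route OPEN; nothing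
booked. `--supports stmt-BirchSwinnertonDyer-19606`.

References: [MazurTateTeitelbaum1986Invent] §I.13 (coordinates), §I.17 (functional equation);
[Kobayashi2003] §3 (p. 6), Thm. 3.2, (3.4)–(3.6); [AtkinLehner1970] Thm. 3; [Washington1997] §7.2, §13.2.
Tree: `Additive/QuadraticBranchMazurTateElement.lean` (bsd-potss-ctrl), `PAdicLFunctionInvolutionProofs.lean`,
`AtkinLehner{,Minus}SymbolSymmetryProofs.lean`, `AtkinLehnerFrickeLevelProofs.lean`.
-/

set_option autoImplicit false
set_option linter.dupNamespace false
noncomputable section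

open scoped Classical MatrixGroups ModularForm

open CongruenceSubgroup Polynomial Literature.NumberTheory.EllipticCurves
  Literature.NumberTheory.EllipticCurves.ModularForms
open Summit.BirchSwinnertonDyer.Rank1Residual.Additive

namespace Summit.BirchSwinnertonDyer.BirchSwinnertonDyer.Theorems.EtaThetaFunctionalEquation

variable {p : ℕ} [hp : Fact p.Prime]

/-! ## §1 Complements on the sign `η(w) = w^{(p−1)/2}` -/

/-- `η(1) = 1`. [folklore] -/
theorem teichSign_one : teichSign p (1 : rootsOfUnity (torsionOrder p) ℤ_[p]) = 1 := by
  unfold teichSign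
  rw [if_pos]
  simp

/-- `η(w⁻¹) = η(w)` (the values are `±1`). [folklore] -/
theorem teichSign_inv (hp2 : p ≠ 2) (w : rootsOfUnity (torsionOrder p) ℤ_[p]) :
    teichSign p w⁻¹ = teichSign p w := by
  have h := teichSign_mul p hp2 w w⁻¹
  rw [mul_inv_cancel, teichSign_one] at h
  rcases teichSign_eq_one_or p w with h1 | h1 <;> rw [h1] at h ⊢ <;> linarith

/-- `η(a / b) = η(a) · η(b)`. [folklore] -/
theorem teichSign_div (hp2 : p ≠ 2) (a b : rootsOfUnity (torsionOrder p) ℤ_[p]) :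
    teichSign p (a / b) = teichSign p a * teichSign p b := by
  rw [div_eq_mul_inv, teichSign_mul p hp2, teichSign_inv hp2]

/-- The value of `η` on the partner `(−1)·η_N⁻¹·w⁻¹` of `w` under the Fricke involution:
`η((−1) η_N⁻¹ w⁻¹) = η(−1) η(η_N) η(w)`. [folklore] -/
theorem teichSign_partner (hp2 : p ≠ 2) (m1 ηN w : rootsOfUnity (torsionOrder p) ℤ_[p]) :
    teichSign p (m1 / ηN / w) = teichSign p m1 * teichSign p ηN * teichSign p w := by
  rw [teichSign_div hp2, teichSign_div hp2]


/-- `η(−1) = (−1)^{(p−1)/2}` (odd `p`): the sign of `−1 ∈ μ_{p−1}`. [folklore] -/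
theorem teichSign_negOne (hp2 : p ≠ 2) :
    teichSign p ⟨-1, neg_one_mem_rootsOfUnity_torsionOrder p⟩ = (-1) ^ (p / 2) := by
  have hτ : torsionOrder p / 2 = p / 2 := by
    rw [torsionOrder_eq, if_neg hp2]
    rcases hp.out.eq_two_or_odd with h | h
    · exact absurd h hp2
    · omega
  unfold teichSign
  have hval : (((⟨-1, neg_one_mem_rootsOfUnity_torsionOrder p⟩ : rootsOfUnity (torsionOrder p) ℤ_[p]) :
      ℤ_[p]ˣ) : ℤ_[p]) = -1 := by
    simp
  rw [hval, hτ]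
  rcases Nat.even_or_odd (p / 2) with he | ho
  · rw [if_pos (he.neg_one_pow.trans rfl), he.neg_one_pow]
  · have hne : ((-1 : ℤ_[p])) ^ (p / 2) ≠ 1 := by
      rw [ho.neg_one_pow]
      intro h1
      have h2 : (2 : ℤ_[p]) = 0 := by linear_combination -h1
      have h3 : (p : ℕ) ∣ 2 := by
        have h4 : ‖((2 : ℤ) : ℤ_[p])‖ < 1 := by
          rw [show ((2 : ℤ) : ℤ_[p]) = 2 by norm_cast, h2, norm_zero]; exact one_pos
        exact_mod_cast (PadicInt.norm_int_lt_one_iff_dvd 2).mp h4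
      exact hp2 ((Nat.prime_dvd_prime_iff_eq hp.out Nat.prime_two).mp h3)
    rw [if_neg hne, ho.neg_one_pow]

/-! ## §2 The Fricke symmetry of the branch symbols `[u/p^L]^δ_f` -/

section Symbol

variable {N : ℕ} [NeZero N] {f : CuspForm (Gamma0 N) 2}

/-- **Fricke symmetry of the branch symbols.** Let `f ∈ S₂(Γ₀(N))` satisfy `w_N f = −σ f`
(`atkinLehnerInvolution N 2 N f = (−σ) • f`, `σ ∈ ℤ`, `σ² = 1`; for the newform of an elliptic curve
`V` of conductor `N`, `σ = w_V` is the root number), and let `u, u'` be classes modulo `p^L`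
with `N u u' = −1`. Then `[u/p^L]^δ_f = σ · [u'/p^L]^δ_f` for the branch symbol of either parity
(`[·]⁺` for `p ≡ 1 (mod 4)`, `[·]⁻` for `p ≡ 3 (mod 4)`): the tree's Atkin–Lehner symmetries
`ratPlusSymbol_div_eq_mul_atkinLehner` / `ratMinusSymbol_div_eq_mul_atkinLehner` at `Q = N`, `m = p^L`
(`N ∣ N p^L`), with the determinant relation `A p^L − u N u' = 1` for the representatives in `[0, p^L)`.
[cite: MazurTateTeitelbaum1986Invent, §I.17] -/
theorem branchSymbol_eq_mul_of_fricke {σ : ℤ} (hσ : σ ^ 2 = 1)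
    (hW : atkinLehnerInvolution N 2 N f = (-(σ : ℂ)) • f) {L : ℕ}
    {u u' : ZMod (p ^ L)} (h : (N : ZMod (p ^ L)) * u * u' = -1) :
    branchSymbol p f ((u.val : ℚ) / (p : ℚ) ^ L) = σ * branchSymbol p f ((u'.val : ℚ) / (p : ℚ) ^ L) := by
  haveI : NeZero (p ^ L) := ⟨pow_ne_zero _ hp.out.ne_zero⟩
  have hc : Nat.Coprime N (N / N) := by
    rw [Nat.div_self (NeZero.pos N)]
    exact Nat.coprime_one_right N
  have hNm : N ∣ N * p ^ L := dvd_mul_right N _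
  have hdvd : ((p ^ L : ℕ) : ℤ) ∣ (N : ℤ) * u.val * u'.val + 1 := by
    rw [← ZMod.intCast_zmod_eq_zero_iff_dvd]
    push_cast
    rw [ZMod.natCast_zmod_val, ZMod.natCast_zmod_val, h, neg_add_cancel]
  obtain ⟨A, hA⟩ := hdvd
  have h1 : A * ((p ^ L : ℕ) : ℤ) - (u.val : ℤ) * (N * (u'.val : ℤ)) = 1 := by
    linear_combination -hA
  unfold branchSymbol
  split_ifs
  · have k := ratPlusSymbol_div_eq_mul_atkinLehner (dvd_refl N) hc f hW hσ (pow_pos hp.out.pos L) hNm h1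
    push_cast at k
    exact k
  · have k := ratMinusSymbol_div_eq_mul_atkinLehner f (dvd_refl N) hc hW hσ (pow_pos hp.out.pos L) hNm h1
    push_cast at k
    exact k

/-- For the newform of level `N` (`IsNewform0 f`) the Fricke sign exists: `w_N f = −σ f` with `σ = ±1`
(`σ = −ε(f)`; Atkin–Lehner 1970, Thm. 3, a tree theorem `IsNewform0.exists_frickeInvolution_eq_smul_holds`,
and `w_{Q=N} = w_N`, `atkinLehnerInvolution_self_eq_frickeInvolution`). [cite: AtkinLehner1970, Thm. 3] -/
theorem exists_frickeSign_of_isNewform0 (hf0 : IsNewform0 f) :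
    ∃ σ : ℤ, σ ^ 2 = 1 ∧ atkinLehnerInvolution N 2 N f = (-(σ : ℂ)) • f := by
  obtain ⟨ε, hε, hεf⟩ := IsNewform0.exists_frickeInvolution_eq_smul_holds hf0
  rcases hε with rfl | rfl
  · refine ⟨-1, by norm_num, ?_⟩
    rw [atkinLehnerInvolution_self_eq_frickeInvolution, hεf]; norm_num
  · refine ⟨1, by norm_num, ?_⟩
    rw [atkinLehnerInvolution_self_eq_frickeInvolution, hεf]; norm_num

end Symbol

/-! ## §3 The involution `(w, s) ↦ ((−1) η_N⁻¹ w⁻¹, −s_N − s)` of `μ_{p−1} × ℤ/pⁿ` -/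

/-- **The partner class.** If `N ≡ η_N γ^{s_N} (mod p^{n+e₀})`, then for every `(w, s)` the classes
`u = w γ^s` and `u' = ((−1) η_N⁻¹ w⁻¹) γ^{−s_N − s}` satisfy `N u u' = −1` — the involution
`x ↦ −1/(Nx)` of `(ℤ/p^{n+e₀})^×` in the coordinates of the Riemann sums (the step `hkey` of the tree's
`finsum_sum_classes_eq_mul_of_symmetry`, isolated). [cite: MazurTateTeitelbaum1986Invent, §I.17] -/
theorem natCast_mul_class_mul_partnerClass (n : ℕ) {ηN : rootsOfUnity (torsionOrder p) ℤ_[p]}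
    {sN : ZMod (p ^ n)} {N : ℕ}
    (hν : PadicInt.toZModPow (n + cyclotomicExponent p) ((ηN : ℤ_[p]ˣ) : ℤ_[p]) *
        (cyclotomicGenerator p : ZMod (p ^ (n + cyclotomicExponent p))) ^ sN.val =
          (N : ZMod (p ^ (n + cyclotomicExponent p))))
    (w : rootsOfUnity (torsionOrder p) ℤ_[p]) (s : ZMod (p ^ n)) :
    (N : ZMod (p ^ (n + cyclotomicExponent p))) *
        (PadicInt.toZModPow (n + cyclotomicExponent p) ((w : ℤ_[p]ˣ) : ℤ_[p]) *
          (cyclotomicGenerator p : ZMod (p ^ (n + cyclotomicExponent p))) ^ s.val) *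
        (PadicInt.toZModPow (n + cyclotomicExponent p)
            (((⟨-1, neg_one_mem_rootsOfUnity_torsionOrder p⟩ / ηN / w :
              rootsOfUnity (torsionOrder p) ℤ_[p]) : ℤ_[p]ˣ) : ℤ_[p]) *
          (cyclotomicGenerator p : ZMod (p ^ (n + cyclotomicExponent p))) ^ (-sN - s).val) = -1 := by
  set m1 : rootsOfUnity (torsionOrder p) ℤ_[p] := ⟨-1, neg_one_mem_rootsOfUnity_torsionOrder p⟩ with hm1
  rw [← hν, ← classMap_mul p n ηN w sN s, ← classMap_mul p n (ηN * w) (m1 / ηN / w) (sN + s) (-sN - s)]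
  have h1 : ηN * w * (m1 / ηN / w) = m1 := by
    rw [mul_comm ηN w, div_div, mul_comm ηN w, mul_div_cancel]
  have h2 : sN + s + (-sN - s) = 0 := by ring
  rw [h1, h2, hm1]
  exact classMap_neg_one p n

/-! ## §4 THE COEFFICIENT SYMMETRY `B_n(s) = w · B_n(−s_N − s)` -/

section Coefficients

variable {N : ℕ} [NeZero N] {f : CuspForm (Gamma0 N) 2}

/-- **The functional equation of `θ_n(η)` at the level of its coefficients.** Write
`θ_n(f, η, T) = ∑_{s mod pⁿ} B_n(s) (1+T)^s` with `B_n(s) = ∑_{w ∈ μ_{p−1}} η(w) [w γ^s / p^{n+e₀}]^δ_f`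
(the tree's definition `quadraticBranchMazurTateElement`). If `w_N f = −σ f` (`σ² = 1`) and
`N ≡ η_N γ^{s_N} (mod p^{n+e₀})`, then for every `s`:
`B_n(s) = σ · η(−1) · η(η_N) · B_n(−s_N − s)`.
Proof: Fricke `[u/M]^δ = σ[u'/M]^δ` for the partner classes (`branchSymbol_eq_mul_of_fricke`,
`natCast_mul_class_mul_partnerClass`), `η(w) = η(−1)η(η_N)η(w')` for `w' = (−1)η_N⁻¹w⁻¹` because `η` is
QUADRATIC (`teichSign_partner`; the factor `η(−N)` of the general tame twist appears squared and cancels),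
and `w ↦ w'` is an involution of `μ_{p−1}`. This is Mazur–Tate–Teitelbaum's functional equation (§I.17)
`L_p(T^ι, ψ̄) = −ε ψ(−N)⟨N⟩^{…} L_p(T, ψ)` for the self-dual tame character `ψ = η = ω^{(p−1)/2}`.
[cite: MazurTateTeitelbaum1986Invent, §I.17] -/
theorem coeffSum_eq_sign_mul_coeffSum (hp2 : p ≠ 2) {σ : ℤ} (hσ : σ ^ 2 = 1)
    (hW : atkinLehnerInvolution N 2 N f = (-(σ : ℂ)) • f) (n : ℕ)
    [Fintype (rootsOfUnity (torsionOrder p) ℤ_[p])]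
    {ηN : rootsOfUnity (torsionOrder p) ℤ_[p]} {sN : ZMod (p ^ n)}
    (hν : PadicInt.toZModPow (n + cyclotomicExponent p) ((ηN : ℤ_[p]ˣ) : ℤ_[p]) *
        (cyclotomicGenerator p : ZMod (p ^ (n + cyclotomicExponent p))) ^ sN.val =
          (N : ZMod (p ^ (n + cyclotomicExponent p))))
    (s : ZMod (p ^ n)) :
    ∑ w : rootsOfUnity (torsionOrder p) ℤ_[p], (teichSign p w : ℚ) * branchSymbol p f
        (((PadicInt.toZModPow (n + cyclotomicExponent p) ((w : ℤ_[p]ˣ) : ℤ_[p]) *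
            (cyclotomicGenerator p : ZMod (p ^ (n + cyclotomicExponent p))) ^ s.val).val : ℚ) /
          (p : ℚ) ^ (n + cyclotomicExponent p)) =
      (σ * teichSign p ⟨-1, neg_one_mem_rootsOfUnity_torsionOrder p⟩ * teichSign p ηN : ℤ) *
        ∑ w : rootsOfUnity (torsionOrder p) ℤ_[p], (teichSign p w : ℚ) * branchSymbol p f
          (((PadicInt.toZModPow (n + cyclotomicExponent p) ((w : ℤ_[p]ˣ) : ℤ_[p]) *
              (cyclotomicGenerator p : ZMod (p ^ (n + cyclotomicExponent p))) ^ (-sN - s).val).val : ℚ) /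
            (p : ℚ) ^ (n + cyclotomicExponent p)) := by
  set m1 : rootsOfUnity (torsionOrder p) ℤ_[p] := ⟨-1, neg_one_mem_rootsOfUnity_torsionOrder p⟩ with hm1
  -- the involution of `μ_{p−1}`
  have hιι : Function.Involutive (fun w : rootsOfUnity (torsionOrder p) ℤ_[p] ↦ m1 / ηN / w) := by
    intro w; dsimp only; rw [div_div_cancel]
  -- termwise: `η(w)[u] = sign · η(w')[u']`
  have step : ∀ w : rootsOfUnity (torsionOrder p) ℤ_[p],
      (teichSign p w : ℚ) * branchSymbol p f
        (((PadicInt.toZModPow (n + cyclotomicExponent p) ((w : ℤ_[p]ˣ) : ℤ_[p]) *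
            (cyclotomicGenerator p : ZMod (p ^ (n + cyclotomicExponent p))) ^ s.val).val : ℚ) /
          (p : ℚ) ^ (n + cyclotomicExponent p)) =
      (σ * teichSign p m1 * teichSign p ηN : ℤ) *
        ((teichSign p (m1 / ηN / w) : ℚ) * branchSymbol p f
          (((PadicInt.toZModPow (n + cyclotomicExponent p) (((m1 / ηN / w :
              rootsOfUnity (torsionOrder p) ℤ_[p]) : ℤ_[p]ˣ) : ℤ_[p]) *
              (cyclotomicGenerator p : ZMod (p ^ (n + cyclotomicExponent p))) ^ (-sN - s).val).val : ℚ) /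
            (p : ℚ) ^ (n + cyclotomicExponent p))) := by
    intro w
    rw [branchSymbol_eq_mul_of_fricke hσ hW (natCast_mul_class_mul_partnerClass n hν w s), ← hm1]
    have h1 := teichSign_mul_self p (R := ℚ) m1
    have h2 := teichSign_mul_self p (R := ℚ) ηN
    have hη : (teichSign p w : ℚ) = teichSign p m1 * teichSign p ηN * teichSign p (m1 / ηN / w) := by
      rw [teichSign_partner hp2, Int.cast_mul, Int.cast_mul]
      linear_combination (-(teichSign p w : ℚ)) * h1 -
        (teichSign p w : ℚ) * ((teichSign p m1 : ℤ) : ℚ) ^ 2 * h2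
    rw [hη]
    simp only [Int.cast_mul]
    ring
  rw [Finset.mul_sum, Fintype.sum_congr _ _ step]
  exact Fintype.sum_bijective _ hιι.bijective _ _ fun w ↦ rfl

end Coefficients

/-! ## §5 The sign, computed: `η(η_N) = (N | p)`, so `σ · η(−1) · η(η_N) = σ · (−N | p)` -/

/-- **The Teichmüller part of `N` has sign `η(η_N) = (N | p)`** (Legendre symbol): reduce
`N ≡ η_N γ^{s_N}` modulo `p` (`γ ≡ 1`), so `η_N ≡ N (mod p)`, and `η(η_N) = η_N^{(p−1)/2} ≡ N^{(p−1)/2}`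
is Euler's criterion (Mathlib `legendreSym.eq_pow`). [folklore] -/
theorem teichSign_eq_legendreSym (hp2 : p ≠ 2) {n : ℕ} {ηN : rootsOfUnity (torsionOrder p) ℤ_[p]}
    {sN : ZMod (p ^ n)} {N : ℕ} (hpN : ¬ p ∣ N)
    (hν : PadicInt.toZModPow (n + cyclotomicExponent p) ((ηN : ℤ_[p]ˣ) : ℤ_[p]) *
        (cyclotomicGenerator p : ZMod (p ^ (n + cyclotomicExponent p))) ^ sN.val =
          (N : ZMod (p ^ (n + cyclotomicExponent p)))) :
    teichSign p ηN = legendreSym p N := by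
  have hp' := hp.out
  haveI : Fact (2 < p) := ⟨lt_of_le_of_ne hp'.two_le (Ne.symm hp2)⟩
  -- reduce `hν` modulo `p^{e₀}` (`γ ≡ 1`), then transport `ZMod (p^{e₀}) ≃ ZMod p` (`e₀ = 1`)
  have he : p ^ cyclotomicExponent p = p := by
    rw [cyclotomicExponent, if_neg hp2, pow_one]
  have hle : cyclotomicExponent p ≤ n + cyclotomicExponent p := Nat.le_add_left _ _
  have key : PadicInt.toZModPow (cyclotomicExponent p) ((ηN : ℤ_[p]ˣ) : ℤ_[p]) =
      (N : ZMod (p ^ cyclotomicExponent p)) := by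
    have h := congr_arg (ZMod.castHom (pow_dvd_pow p hle) (ZMod (p ^ cyclotomicExponent p))) hν
    simp only [map_mul, map_pow, map_natCast, cyclotomicGenerator_cast_cyclotomicExponent,
      one_pow, mul_one, ZMod.castHom_apply, PadicInt.cast_toZModPow _ _ hle] at h
    exact h
  set ψ : ZMod (p ^ cyclotomicExponent p) ≃+* ZMod p := ZMod.ringEquivCongr he with hψ
  set φ : ℤ_[p] →+* ZMod p := ψ.toRingHom.comp (PadicInt.toZModPow (cyclotomicExponent p)) with hφ
  have hφη : φ ((ηN : ℤ_[p]ˣ) : ℤ_[p]) = (N : ZMod p) := by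
    rw [hφ, RingHom.comp_apply, key]
    simp
  -- `η(η_N) ≡ N^{(p−1)/2} (mod p)`
  have hτ : torsionOrder p / 2 = p / 2 := by
    rw [torsionOrder_eq, if_neg hp2]
    rcases hp'.eq_two_or_odd with h | h
    · exact absurd h hp2
    · omega
  have h1 : ((teichSign p ηN : ℤ) : ZMod p) = (N : ZMod p) ^ (p / 2) := by
    have h := congr_arg φ (cast_teichSign_eq_pow p hp2 ηN)
    rw [map_intCast, map_pow, hφη, hτ] at h
    exact h
  have h2 : ((legendreSym p N : ℤ) : ZMod p) = (N : ZMod p) ^ (p / 2) := by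
    rw [legendreSym.eq_pow]; push_cast; rfl
  have hN0 : ((N : ℤ) : ZMod p) ≠ 0 := by
    rw [Int.cast_natCast, Ne, ZMod.natCast_eq_zero_iff]
    exact hpN
  have h3 : ((teichSign p ηN : ℤ) : ZMod p) = ((legendreSym p N : ℤ) : ZMod p) := h1.trans h2.symm
  rcases teichSign_eq_one_or p ηN with ht | ht <;>
    rcases legendreSym.eq_one_or_neg_one p hN0 with hl | hl
  · rw [ht, hl]
  · exfalso; rw [ht, hl] at h3; push_cast at h3
    exact (Ring.neg_one_ne_one_of_char_ne_two (by
      rw [ZMod.ringChar_zmod_n]; exact hp2)) h3.symm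
  · exfalso; rw [ht, hl] at h3; push_cast at h3
    exact (Ring.neg_one_ne_one_of_char_ne_two (by
      rw [ZMod.ringChar_zmod_n]; exact hp2)) h3
  · rw [ht, hl]

/-- **The sign of the functional equation on the quadratic branch is `σ · (−N | p)`**:
`σ · η(−1) · η(η_N) = σ · (−1 | p)(N | p) = σ · (−N | p)`; for the newform of an elliptic curve `V` of
conductor `N` (`σ = w_V`) this is `w_V · η(−N_V) = w(V ⊗ η)`, the root number of the ADDITIVE PARTNER
`W = V^{(p*)}`. [folklore] -/
theorem sign_eq_mul_legendreSym_neg (hp2 : p ≠ 2) {n : ℕ} {ηN : rootsOfUnity (torsionOrder p) ℤ_[p]}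
    {sN : ZMod (p ^ n)} {N : ℕ} (hpN : ¬ p ∣ N)
    (hν : PadicInt.toZModPow (n + cyclotomicExponent p) ((ηN : ℤ_[p]ˣ) : ℤ_[p]) *
        (cyclotomicGenerator p : ZMod (p ^ (n + cyclotomicExponent p))) ^ sN.val =
          (N : ZMod (p ^ (n + cyclotomicExponent p)))) (σ : ℤ) :
    σ * teichSign p ⟨-1, neg_one_mem_rootsOfUnity_torsionOrder p⟩ * teichSign p ηN =
      σ * legendreSym p (-(N : ℤ)) := by
  have hodd : p % 2 = 1 := hp.out.eq_two_or_odd.resolve_left hp2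
  rw [teichSign_negOne hp2, teichSign_eq_legendreSym hp2 hpN hν,
    show (-(N : ℤ)) = (-1) * (N : ℤ) by ring, legendreSym.mul, legendreSym.at_neg_one hp2,
    ZMod.χ₄_eq_neg_one_pow hodd]
  ring

end Summit.BirchSwinnertonDyer.BirchSwinnertonDyer.Theorems.EtaThetaFunctionalEquation

end
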